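import Summits.QuantumFields.YangMills.Theorems.UnitScaleTiltProp8ChartDoubleBarAccumulated
import Literature.MathematicalPhysics.QuantumFieldTheory.Balaban1983to89.BlockAveragingTwoLevel
import Literature.MathematicalPhysics.QuantumFieldTheory.Balaban1983to89.TorusGeometry
import HarnessLib

/-!
# Route `UnitScaleTilt`, crux K1 child «MinimiserStabilityRegPr» (stmt-QuantumFields-19200), stub V2′ `stub_halvingStep` — pillar P1♭, brick **B0** of the
# LEAD plan `T2FLAT-PLAN-w5g4.md` (19200 evidence #44): **EXACT COVARIANCE OF THE DOUBLE-BAR TOWER UNDER BLOCK-CONSTANT GAUGE MAPS**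
# ([Balaban1985Averaging] (11) p.19, (89) p.31, (92)∕(97)–(100) pp.31–32, (110) p.34)

Cell `ym3-torus` (HUMAN RULING D-0037: YM₃ on T³ is ladder rung R3, not the Clay problem), LEAD seat `ym-ust-19200-w5` gen 4.
`--supports stmt-QuantumFields-19200 --as helper`; def-free, 0 sorry, standard axioms.  Nothing here claims the stub, the crux or the gap.

WHY.  The P1♭ `core` of ✓`HalvingP1FlatPillarRows.p1FlatPillarAt_of_core` (WANTED №g26-5) carries the designed top normalisation (o) `DP1Clause`:
«`U̿^{(k)}(U^{u⁻¹}) = ` the axial copy of `V̄` on the top cube».  By ✓`Prop8ChartDoubleBar.dbarIterU_gaugeActT_eq` the double-bar tower of a gauge copy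
`U^{g}` is `(Ū^{(k)}U)^{ḡ}` with `ḡ = V_k(U^g)⁻¹·(g∘emb^k)` — the accumulated frames of the TRANSFORMED field enter, so (o) is a priori a fixed-point
condition on `g`.  THIS FILE proves the structural fact that makes (o) solvable level by level (plan §2 F-c): for a gauge map that is CONSTANT ON BLOCKS
(read at every level through the block centres, `us (i+1) = us i ∘ emb`, and block-constant below the top, `us i = us (i+1) ∘ blockOf`), the frames
CONJUGATE (`v(W^{c}) = c·v(W)·c⁻¹`, because every centre stair stays in its block and `exp[mean log]` commutes with conjugation — (0.6),
✓`ExpMeanLog.eml_conj`), hence the WHOLE double-bar tower is exactly covariant: `U̿^{(j)}(U^{c·g}) = (U̿^{(j)}(U^{g}))^{c_j}` — no frame correction at all.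
Consequently the `#topsites` group conditions of (o) are met EXACTLY by the `#topsites` top-block constants (brick B1 then smooths them; plan §3).

WHAT IS PROVED (generic complete normed `ℂ`-algebra `𝔸`; `P : Params`; no smallness anywhere):
* §1 `vframeU_gaugeActT_of_stairConst` — if `u` takes the same value at the centre `emb y` and at the end of every centre stair of the block of `y`, then
  `vframeU (W^{u}) y = u(emb y)·vframeU W y·u(emb y)⁻¹`.
* §2 `dbarAvgU_gaugeActT_of_stairConst` — one double-bar step: `U̿(W^{u}) = (U̿ W)^{u∘emb}` for such `u` (compare ✓`dbarAvgU_gaugeActT`: general `u`, frame-twisted).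
* §3 `stairConst_of_blockConst` — a BLOCK-CONSTANT gauge map (`u = f ∘ blockOf`) is stair-constant (✓`blockOf_walkEnd_take_stairWord`, ✓`Site.blockOf_emb`; standing range
  `j + 1 ≤ P.m + P.K`); `dbarAvgU_gaugeActT_of_blockConst`, `vframeU_gaugeActT_of_blockConst`.
* §4 ★ `dbarIterU_gaugeActT_of_blockConst` — THE TOWER: for `us : (i : ℕ) → GaugeTransf P i 𝔸ˣ` with `us (i+1) y = us i (emb y)` and `us i z = us (i+1) (blockOf z)`
  for `i < j` (`j ≤ P.m + P.K`): `dbarIterU j (U^{us 0}) = (dbarIterU j U)^{us j}`; ★ `vframeU_dbarIterU_gaugeActT_of_blockConst` (the level-`j` frames of the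
  transformed tower conjugate by `us (j+1)`), `coe_dbarIterU_gaugeActT_of_blockConst` (bond values).
* §5 `dbarIterU_gaugeActT_mul_of_blockConst` — the form used by B1: `U̿^{(j)}(U^{c·g}) = (U̿^{(j)}(U^{g}))^{c_j}` (✓`gaugeActT_gaugeActT`).
HONEST SCOPE: identities of the formal objects; NOT the first-order «average absorption» (plan F-d), NOT the pre-gauge B1, NOT [B8] Thm 2.

References: T. Bałaban, CMP **98** (1985) 17–51 [Balaban1985Averaging]; CMP **109** (1987) 249–301 [Balaban1987RG1] ((0.3)–(0.6) pp.252–253, centred blocks).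
-/

set_option autoImplicit false

noncomputable section

namespace Summit.QuantumFields.YangMills.Theorems.P1FlatCoreCovariance

open Literature.MathematicalPhysics.QuantumFieldTheory.Balaban1983to89
open T4Continuum BlockAveraging ExpMeanLog MatrixLog
open B10Eq27TorusAxialLog (holT gaugeActT gaugeActT_apply)
open Summit.QuantumFields.YangMills.Theorems.Prop8Chart (emlAvgU emlIterU emlAvgU_gaugeActT holT_gaugeActT)
open Summit.QuantumFields.YangMills.Theorems.Prop8ChartDoubleBar (vframeU coe_vframeU dbarAvgU dbarAvgU_eq_gaugeActT dbarAvgU_gaugeActT dbarIterU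
  dbarIterU_zero dbarIterU_succ gaugeActT_gaugeActT)

variable {P : Params} {𝔸 : Type*} [NormedRing 𝔸] [NormedAlgebra ℂ 𝔸] [CompleteSpace 𝔸]

/-! ## §1 Frames of a gauge copy under a stair-constant gauge map -/

section Frame

variable {j : ℕ}

/-- **THE BLOCK FRAME CONJUGATES** under a gauge map taking the same value at the block centre and at the end of every centre stair of the block:
`v(W^{u})(y) = u(emb y)·v(W)(y)·u(emb y)⁻¹` (the stair transporters of `W^{u}` are those of `W` conjugated by `u(emb y)`, ✓`holT_gaugeActT`; `exp[mean log]`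
commutes with conjugation, ✓`ExpMeanLog.eml_conj`). [cite: Balaban1985Averaging, (110) p.34, (8)-(9) pp.18-19; Balaban1987RG1, (0.6) p.253] -/
theorem vframeU_gaugeActT_of_stairConst (u : GaugeTransf P j 𝔸ˣ) (W : GaugeField P j 𝔸ˣ) (y : Site P (j + 1))
    (h : ∀ i : Idx P, u (walkEnd (emb y) (stairWord i.2.1 (off i.1))) = u (emb y)) :
    vframeU (gaugeActT u W) y = u (emb y) * vframeU W y * (u (emb y))⁻¹ := by
  apply Units.ext
  rw [Units.val_mul, Units.val_mul, coe_vframeU, coe_vframeU]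
  have hfam : (fun i : Idx P => ((holT (gaugeActT u W) (emb y) (stairWord i.2.1 (off i.1)) : 𝔸ˣ) : 𝔸)) =
      fun i => ((u (emb y) : 𝔸ˣ) : 𝔸) * ((holT W (emb y) (stairWord i.2.1 (off i.1)) : 𝔸ˣ) : 𝔸) * (((u (emb y))⁻¹ : 𝔸ˣ) : 𝔸) := by
    funext i
    rw [holT_gaugeActT, h i, Units.val_mul, Units.val_mul]
  rw [hfam, eml_conj (Units.mul_inv _) (Units.inv_mul _)]

end Frame

/-! ## §2 One double-bar step -/

section Step

variable {j : ℕ}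

/-- **ONE DOUBLE-BAR STEP IS EXACTLY COVARIANT under a stair-constant gauge map**: `U̿(W^{u}) = (U̿ W)^{u ∘ emb}` — (89) `U̿ = (Ū)^{v⁻¹}`, the covariance
(11) of the single bar, and §1 (the frame twist of ✓`dbarAvgU_gaugeActT` cancels). [cite: Balaban1985Averaging, (11) p.19, (89) p.31, (110) p.34] -/
theorem dbarAvgU_gaugeActT_of_stairConst (u : GaugeTransf P j 𝔸ˣ) (W : GaugeField P j 𝔸ˣ)
    (h : ∀ (y : Site P (j + 1)) (i : Idx P), u (walkEnd (emb y) (stairWord i.2.1 (off i.1))) = u (emb y)) :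
    dbarAvgU (gaugeActT u W) = gaugeActT (fun y : Site P (j + 1) => u (emb y)) (dbarAvgU W) := by
  rw [dbarAvgU_gaugeActT, dbarAvgU_eq_gaugeActT, gaugeActT_gaugeActT]
  congr 1
  funext y
  rw [vframeU_gaugeActT_of_stairConst u W y (h y), mul_inv_rev, mul_inv_rev, inv_inv, mul_assoc, mul_assoc, inv_mul_cancel, mul_one]

end Step

/-! ## §3 Block-constant gauge maps are stair-constant -/

section BlockConst

variable {j : ℕ}

/-- Every centre stair of the block of `y` ENDS in the block of `y` (standing range). [cite: Balaban1987RG1, (0.3) p.252] -/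
theorem blockOf_walkEnd_stairWord (hj : j + 1 ≤ P.m + P.K) (y : Site P (j + 1)) (i : Idx P) :
    blockOf (walkEnd (emb y) (stairWord i.2.1 (off i.1))) = y := by
  have h := blockOf_walkEnd_take_stairWord hj y i.1 i.2.1 (stairWord i.2.1 (off i.1)).length
  rwa [List.take_length] at h

omit [NormedAlgebra ℂ 𝔸] [CompleteSpace 𝔸] in
/-- **A BLOCK-CONSTANT GAUGE MAP IS STAIR-CONSTANT**: if `u = f ∘ blockOf` then `u` takes the value `f y = u(emb y)` at the end of every centre stair of the
block of `y`. [cite: Balaban1987RG1, (0.3) p.252] -/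
theorem stairConst_of_blockConst (hj : j + 1 ≤ P.m + P.K) (u : GaugeTransf P j 𝔸ˣ) (f : Site P (j + 1) → 𝔸ˣ)
    (hu : ∀ z : Site P j, u z = f (blockOf z)) (y : Site P (j + 1)) (i : Idx P) :
    u (walkEnd (emb y) (stairWord i.2.1 (off i.1))) = u (emb y) := by
  rw [hu, hu, blockOf_walkEnd_stairWord hj y i, Site.blockOf_emb hj y]

/-- The frame of a gauge copy by a BLOCK-CONSTANT map conjugates by the block's constant. [cite: Balaban1985Averaging, (110) p.34] -/
theorem vframeU_gaugeActT_of_blockConst (hj : j + 1 ≤ P.m + P.K) (u : GaugeTransf P j 𝔸ˣ) (f : Site P (j + 1) → 𝔸ˣ)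
    (hu : ∀ z : Site P j, u z = f (blockOf z)) (W : GaugeField P j 𝔸ˣ) (y : Site P (j + 1)) :
    vframeU (gaugeActT u W) y = f y * vframeU W y * (f y)⁻¹ := by
  have hc : u (emb y) = f y := by rw [hu, Site.blockOf_emb hj y]
  rw [vframeU_gaugeActT_of_stairConst u W y (stairConst_of_blockConst hj u f hu y), hc]

/-- One double-bar step of a gauge copy by a BLOCK-CONSTANT map: `U̿(W^{f∘blockOf}) = (U̿ W)^{f}`. [cite: Balaban1985Averaging, (89) p.31, (11) p.19] -/
theorem dbarAvgU_gaugeActT_of_blockConst (hj : j + 1 ≤ P.m + P.K) (u : GaugeTransf P j 𝔸ˣ) (f : Site P (j + 1) → 𝔸ˣ)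
    (hu : ∀ z : Site P j, u z = f (blockOf z)) (W : GaugeField P j 𝔸ˣ) :
    dbarAvgU (gaugeActT u W) = gaugeActT f (dbarAvgU W) := by
  rw [dbarAvgU_gaugeActT_of_stairConst u W (stairConst_of_blockConst hj u f hu)]
  congr 1
  funext y
  rw [hu, Site.blockOf_emb hj y]

end BlockConst

/-! ## §4 The tower -/

section Tower

/-- **THE DOUBLE-BAR TOWER IS EXACTLY COVARIANT UNDER BLOCK-CONSTANT GAUGE MAPS**: for a family `us i : T^{(i)} → 𝔸ˣ` read at the block centres
(`us (i+1) y = us i (emb y)`) and block-constant below level `j` (`us i z = us (i+1) (blockOf z)`, `i < j`), `U̿^{(j)}(U^{us 0}) = (U̿^{(j)} U)^{us j}` —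
induction over §3; no frame correction (contrast ✓`dbarIterU_gaugeActT_eq`, general `us`, accumulated-frame twist). [cite: Balaban1985Averaging, (92) p.31, (97)-(100) p.32, (110) p.34] -/
theorem dbarIterU_gaugeActT_of_blockConst (us : (i : ℕ) → GaugeTransf P i 𝔸ˣ) (U : GaugeField P 0 𝔸ˣ) :
    ∀ j : ℕ, j ≤ P.m + P.K → (∀ i, i < j → ∀ z : Site P i, us i z = us (i + 1) (blockOf z)) →
      dbarIterU j (gaugeActT (us 0) U) = gaugeActT (us j) (dbarIterU j U)
  | 0, _, _ => by rw [dbarIterU_zero, dbarIterU_zero]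
  | j + 1, hj, hblk => by
    have ih := dbarIterU_gaugeActT_of_blockConst us U j (Nat.le_of_succ_le hj) fun i hi z => hblk i (Nat.lt_succ_of_lt hi) z
    rw [dbarIterU_succ, dbarIterU_succ, ih]
    exact dbarAvgU_gaugeActT_of_blockConst hj (us j) (us (j + 1)) (hblk j (Nat.lt_succ_self j)) (dbarIterU j U)

/-- **THE FRAMES OF THE TRANSFORMED TOWER CONJUGATE**: at every level `j < P.m + P.K` with block-constancy up to `j`,
`v(U̿^{(j)}(U^{us 0}))(y) = us (j+1) y · v(U̿^{(j)} U)(y) · (us (j+1) y)⁻¹` — so the ACCUMULATED frames of `U^{us 0}` are those of `U` conjugated. [cite: Balaban1985Averaging, (97) p.32, (110) p.34] -/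
theorem vframeU_dbarIterU_gaugeActT_of_blockConst (us : (i : ℕ) → GaugeTransf P i 𝔸ˣ) (U : GaugeField P 0 𝔸ˣ) (j : ℕ) (hj : j + 1 ≤ P.m + P.K)
    (hblk : ∀ i, i < j + 1 → ∀ z : Site P i, us i z = us (i + 1) (blockOf z)) (y : Site P (j + 1)) :
    vframeU (dbarIterU j (gaugeActT (us 0) U)) y = us (j + 1) y * vframeU (dbarIterU j U) y * (us (j + 1) y)⁻¹ := by
  rw [dbarIterU_gaugeActT_of_blockConst us U j (Nat.le_of_succ_le hj) fun i hi z => hblk i (Nat.lt_succ_of_lt hi) z]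
  exact vframeU_gaugeActT_of_blockConst hj (us j) (us (j + 1)) (hblk j (Nat.lt_succ_self j)) (dbarIterU j U) y

/-- the bond values of the transformed tower: `U̿^{(j)}(U^{us 0})(c) = us j (c₋) · U̿^{(j)}(U)(c) · (us j (c₊))⁻¹`. [cite: Balaban1985Averaging, (92) p.31] -/
theorem coe_dbarIterU_gaugeActT_of_blockConst (us : (i : ℕ) → GaugeTransf P i 𝔸ˣ) (U : GaugeField P 0 𝔸ˣ) (j : ℕ) (hj : j ≤ P.m + P.K)
    (hblk : ∀ i, i < j → ∀ z : Site P i, us i z = us (i + 1) (blockOf z)) (c : PBond P j) :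
    ((dbarIterU j (gaugeActT (us 0) U) c : 𝔸ˣ) : 𝔸) = ((us j c.src : 𝔸ˣ) : 𝔸) * ((dbarIterU j U c : 𝔸ˣ) : 𝔸) * (((us j c.tgt)⁻¹ : 𝔸ˣ) : 𝔸) := by
  rw [dbarIterU_gaugeActT_of_blockConst us U j hj hblk, gaugeActT_apply, Units.val_mul, Units.val_mul]

end Tower

/-! ## §5 The form used by the pre-gauge (plan B1): a block-constant correction on top of an arbitrary fine gauge map -/

section Mul

/-- **`U̿^{(j)}(U^{c·g}) = (U̿^{(j)}(U^{g}))^{c_j}`** for an ARBITRARY fine gauge map `g` and a block-constant family `c` (`cs (i+1) y = cs i (emb y)`,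
`cs i = cs (i+1) ∘ blockOf` below `j`): the top normalisation (o) of the P1♭ `core` is reached from any pre-gauge `g` by choosing the top constants `cs k`,
with NO feedback through the frames (plan §2 F-c). [cite: Balaban1985Averaging, (92) p.31, (8) p.19] -/
theorem dbarIterU_gaugeActT_mul_of_blockConst (cs : (i : ℕ) → GaugeTransf P i 𝔸ˣ) (g : GaugeTransf P 0 𝔸ˣ) (U : GaugeField P 0 𝔸ˣ) (j : ℕ)
    (hj : j ≤ P.m + P.K) (hblk : ∀ i, i < j → ∀ z : Site P i, cs i z = cs (i + 1) (blockOf z)) :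
    dbarIterU j (gaugeActT (fun z => cs 0 z * g z) U) = gaugeActT (cs j) (dbarIterU j (gaugeActT g U)) := by
  rw [← gaugeActT_gaugeActT (cs 0) g U]
  exact dbarIterU_gaugeActT_of_blockConst cs (gaugeActT g U) j hj hblk

/-- the same at a bond: `U̿^{(j)}(U^{c·g})(c′) = cs j (c′₋) · U̿^{(j)}(U^{g})(c′) · (cs j (c′₊))⁻¹`. [cite: Balaban1985Averaging, (92) p.31] -/
theorem coe_dbarIterU_gaugeActT_mul_of_blockConst (cs : (i : ℕ) → GaugeTransf P i 𝔸ˣ) (g : GaugeTransf P 0 𝔸ˣ) (U : GaugeField P 0 𝔸ˣ) (j : ℕ)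
    (hj : j ≤ P.m + P.K) (hblk : ∀ i, i < j → ∀ z : Site P i, cs i z = cs (i + 1) (blockOf z)) (c : PBond P j) :
    ((dbarIterU j (gaugeActT (fun z => cs 0 z * g z) U) c : 𝔸ˣ) : 𝔸) =
      ((cs j c.src : 𝔸ˣ) : 𝔸) * ((dbarIterU j (gaugeActT g U) c : 𝔸ˣ) : 𝔸) * (((cs j c.tgt)⁻¹ : 𝔸ˣ) : 𝔸) := by
  rw [dbarIterU_gaugeActT_mul_of_blockConst cs g U j hj hblk, gaugeActT_apply, Units.val_mul, Units.val_mul]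

end Mul

end Summit.QuantumFields.YangMills.Theorems.P1FlatCoreCovariance

end
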